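import Summits.ResolutionOfSingularities.ResolutionOfSingularities.Theorems.EquisingularLiftEquisingularLiftNatTwoStepVertexA3
import Summits.ResolutionOfSingularities.ResolutionOfSingularities.Theorems.EquisingularLiftEquisingularLiftNatIsoHypPointOfPoints
import Summits.ResolutionOfSingularities.ResolutionOfSingularities.Theorems.EquisingularLiftEquisingularLiftNatTwoStepIsoHypPoint
import HarnessLib

/-!
# [OURS] SEVERAL ONE-STEP AND TWO-STEP SINGULAR VERTICES ⟹ `IsoHypPoint` (the lead's hypothesis #7 of the isolated residual) — every dimension,
# every characteristic, every degree, any two duplicate-tolerant lists of coordinate vertices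
# (cruxes `Theses.EquisingularLift.EquisingularLiftNat` / `…NatThree`, stmt-ResolutionOfSingularities-20038 / -20148)

[OURS · leafhand-res-equisingularlift-12 g0, 2026-08-31; cell `pub/decomp-res`] AI-produced, weaker than expert review; NOT a statement of any manuscript;
nothing here proves resolution of singularities in positive characteristic.  DEF-FREE helper; no `sorry`; standard axioms; ZERO named hypotheses.

Item (L1-multi) of leafhand-11's remaining list: the MULTI-VERTEX form of ✓ `isoHypPoint_of_A₃Vertex` (one `A₃` vertex, all other charts regular) and of
✓ `isoHypPoint_of_oneStepVertices` (several one-step vertices), merged: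

* ★★★ `isoHypPoint_of_twoStepVertices` — `K` algebraically closed, `F ∈ K[x₀,…,x_{m+2}]` a PRIME form, two lists `S₁`, `S₂` of coordinates; for `c ∈ S₁` the
  vertex chart `F(x_c := 1) = Φ + Ψ` carries a ONE-STEP datum (strict transforms `G_l` passing the Jacobian criterion at the primes containing `T_l`), for
  `c ∈ S₂` a TWO-STEP datum (the hypotheses `G, hG, hjac, hsec` of ✓ `twoStepAt_vertex`: strict transforms, the disjunctive Jacobian datum, second-order
  splittings with one-step data at the chart origins); every marked chart singular at most at its origin (Jacobian hypothesis) and NON-REGULAR there; the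
  unmarked charts regular.  Then `IsoHypPoint K (m+2) V₊(F) ι`: the downstairs point chain blows up the two-step vertices first, then all one-step points
  (✓ `isoHypPoint_of_twoStepPoints`).  Pointwise inputs: ✓ `OneStep.isRegularLocalRing_stalk_of_isBlowup_comap` (one-step vertices), ✓ `twoStepAt_vertex`
  (two-step vertices), ✓ `MultiOrd.isRegularLocalRing_stalk_of_forall_exists` (regularity off the vertices), ✓ `exists_vertexPoint` (vertex bookkeeping).
* ★★ `isoHypPoint_of_A₃Vertices` — the same with every `c ∈ S₂` an `A₃` vertex chart
  `F(x_c := 1) = y₀y₁ + ((y₂²(αy₀ + βy₁) + Ψ₁⁰) + (γy₂⁴ + Ψ₂⁰ + Ψ₅))` (`γ ≠ αβ`; surfaces, `m = 1`), the two-step datum being ✓ `SecondOrderPoint.twoStepData_A₃`: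
  a prime surface `V₊(F) ⊆ ℙ³` whose singular points are coordinate vertices of type «one-step» (e.g. ordinary, `A₁`, first-order) or `A₃` satisfies `IsoHypPoint`.

Honest label: closes no registered stub (the registered isolated residual carries `¬ IsoHypPoint`; this certifies further surfaces it EXCLUDES: any finite
configuration of one-step and `A₃` vertices).

References: [Hartshorne1977, I Thm. 5.1, I Ex. 5.6, II Ex. 7.12]; [StacksProject, Tag 080E]; through the cited tree files.
-/

set_option linter.dupNamespace false -- mandated namespace `Summit.<Summit>.<Problem>` of this single-conjunct summit

noncomputable section

open CategoryTheory CategoryTheory.Limits AlgebraicGeometry TopologicalSpace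
open Literature.AlgebraicGeometry.Resolution Literature.AlgebraicGeometry.Motives
open AlgebraicGeometry.Scheme.IdealSheafData
open MvPolynomial HomogeneousLocalization
open Literature.AlgebraicGeometry.Motives.SmoothHypersurface Literature.AlgebraicGeometry.Motives.ProjectiveSpace
open Summit.ResolutionOfSingularities.ResolutionOfSingularities.Cruxes.EquisingularLift.StrataSplit

namespace Summit.ResolutionOfSingularities.ResolutionOfSingularities.Cruxes.EquisingularLiftNat.Sections

/-- ★★★ **SEVERAL ONE-STEP AND TWO-STEP SINGULAR VERTICES ⟹ `IsoHypPoint`** — every dimension, every characteristic; `S₁` = the one-step vertices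
(datum of ✓ `isoHypPoint_of_oneStepVertices`), `S₂` = the two-step vertices (datum of ✓ `twoStepAt_vertex`); marked charts singular at most at the origin and
non-regular there, unmarked charts regular. [OURS] [cite: Hartshorne1977, I Thm. 5.1, II Ex. 7.12] [cite: StacksProject, Tag 080E] -/
theorem isoHypPoint_of_twoStepVertices (K : Type) [Field K] [IsAlgClosed K] {m : ℕ}
    (F : MvPolynomial (Fin (m + 2 + 1)) K) {d : ℕ} (hF : F.IsHomogeneous d) (hFp : Prime F)
    (S₁ S₂ : List (Fin (m + 2 + 1)))
    (hone : ∀ c ∈ S₁, ∃ (μ : ℕ) (Φ Ψ : MvPolynomial (Fin (m + 2)) K), 1 ≤ μ ∧ Φ.IsHomogeneous μ ∧ Φ ≠ 0 ∧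
      Ψ ∈ Ideal.span (Set.range (X : Fin (m + 2) → MvPolynomial (Fin (m + 2)) K)) ^ (μ + 1) ∧ ProjectiveSpace.dehomogenize K c F = Φ + Ψ ∧
      ∀ l : Fin (m + 2), ∃ G : MvPolynomial (Fin (m + 2)) K,
        aeval (fun j => X l * Function.update (X : Fin (m + 2) → MvPolynomial (Fin (m + 2)) K) l 1 j) (Φ + Ψ) = X l ^ μ * G ∧
        ∀ P : Ideal (MvPolynomial (Fin (m + 2)) K), P.IsPrime → (X l : MvPolynomial (Fin (m + 2)) K) ∈ P → G ∈ P → ∃ j, pderiv j G ∉ P)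
    (htwo : ∀ c ∈ S₂, ∃ (μ : ℕ) (Φ Ψ : MvPolynomial (Fin (m + 2)) K) (G : Fin (m + 2) → MvPolynomial (Fin (m + 2)) K),
      1 ≤ μ ∧ Φ.IsHomogeneous μ ∧ Φ ≠ 0 ∧
      Ψ ∈ Ideal.span (Set.range (X : Fin (m + 2) → MvPolynomial (Fin (m + 2)) K)) ^ (μ + 1) ∧ ProjectiveSpace.dehomogenize K c F = Φ + Ψ ∧
      (∀ a, aeval (fun j => X a * Function.update (X : Fin (m + 2) → MvPolynomial (Fin (m + 2)) K) a 1 j) (Φ + Ψ) = X a ^ μ * G a) ∧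
      (∀ a, ∀ P : Ideal (MvPolynomial (Fin (m + 2)) K), P.IsPrime → (X a : MvPolynomial (Fin (m + 2)) K) ∈ P → G a ∈ P →
        (∃ j, pderiv j (G a) ∉ P) ∨ ∀ i, (X i : MvPolynomial (Fin (m + 2)) K) ∈ P) ∧
      (∀ a, G a ∈ Ideal.span (Set.range (X : Fin (m + 2) → MvPolynomial (Fin (m + 2)) K)) →
        ∃ (μ' : ℕ) (Φ' Ψ' : MvPolynomial (Fin (m + 2)) K), 1 ≤ μ' ∧ Φ'.IsHomogeneous μ' ∧ Φ' ≠ 0 ∧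
          Ψ' ∈ Ideal.span (Set.range (X : Fin (m + 2) → MvPolynomial (Fin (m + 2)) K)) ^ (μ' + 1) ∧ G a = Φ' + Ψ' ∧
          ∀ b : Fin (m + 2), ∃ G' : MvPolynomial (Fin (m + 2)) K,
            aeval (fun j => X b * Function.update (X : Fin (m + 2) → MvPolynomial (Fin (m + 2)) K) b 1 j) (Φ' + Ψ') = X b ^ μ' * G' ∧
            ∀ P : Ideal (MvPolynomial (Fin (m + 2)) K), P.IsPrime → (X b : MvPolynomial (Fin (m + 2)) K) ∈ P → G' ∈ P → ∃ j, pderiv j G' ∉ P))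
    (hsing : ∀ c, c ∈ S₁ ∨ c ∈ S₂ → ∀ P : Ideal (MvPolynomial (Fin (m + 2)) K), P.IsPrime → ProjectiveSpace.dehomogenize K c F ∈ P →
      (∀ j, pderiv j (ProjectiveSpace.dehomogenize K c F) ∈ P) → ∀ j, (X j : MvPolynomial (Fin (m + 2)) K) ∈ P)
    (hsingpt : letI := MvPolynomial.gradedAlgebra (σ := Fin (m + 2 + 1)) (R := K)
      ∀ c, c ∈ S₁ ∨ c ∈ S₂ → ∀ x : ↥(hypersurface F).left, (∀ a : Fin (m + 2 + 1), a ≠ c →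
        (X a : MvPolynomial (Fin (m + 2 + 1)) K) ∈ ((hypersurfaceι F).left x).asHomogeneousIdeal) →
        ¬ IsRegularLocalRing ((hypersurface F).left.presheaf.stalk x))
    (hoff : letI := MvPolynomial.gradedAlgebra (σ := Fin (m + 2 + 1)) (R := K)
      ∀ c, c ∉ S₁ → c ∉ S₂ → IsRegularRing (ChartRing F c hF)) :
    letI := MvPolynomial.gradedAlgebra (σ := Fin (m + 2 + 1)) (R := K)
    IsoHypPoint K (m + 2) (hypersurface F).left (hypersurfaceι F).left := by
  letI := MvPolynomial.gradedAlgebra (σ := Fin (m + 2 + 1)) (R := K)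
  letI := MvPolynomial.gradedAlgebra (σ := Fin (0 + 1)) (R := K)
  classical
  haveI := HypersurfaceSpecimen.isIntegral_hypersurface_of_prime K F hF hFp
  have hd : 0 < d := ConeN.pos_of_prime_of_isHomogeneous K F hF hFp
  have hιinj : Function.Injective (hypersurfaceι F).left := (hypersurfaceι F).left.isClosedEmbedding.injective
  have he : ∀ c : Fin (m + 2 + 1), Function.Injective (fun _ : Fin 1 => c) := fun c => Function.injective_of_subsingleton _
  have hec : ∀ c : Fin (m + 2 + 1), ∀ j : Fin 1, (fun _ : Fin 1 => c) j = c := fun _ _ => rfl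
  have hexk : ∀ c : Fin (m + 2 + 1), ∃ (g : homogeneousSubmodule (Fin (m + 2 + 1)) K →+*ᵍ homogeneousSubmodule (Fin (0 + 1)) K)
      (_ : HomogeneousIdeal.irrelevant (homogeneousSubmodule (Fin (0 + 1)) K) ≤
        (HomogeneousIdeal.irrelevant (homogeneousSubmodule (Fin (m + 2 + 1)) K)).map g),
      (∀ a : K, g (C a) = C a) ∧ (∀ j : Fin 1, g (X ((fun _ : Fin 1 => c) j)) = X j) ∧
        (∀ i : Fin (m + 2 + 1), i ∉ Set.range (fun _ : Fin 1 => c) → g (X i) = 0) := fun c =>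
    LinearCentre.exists_kill (R := K) (fun _ : Fin 1 => c) (he c)
  choose fk hfk' hfkC hfke hfk0 using hexk
  have hfke' : ∀ c (j : Fin 1), fk c (X c) = X j := fun c j => hfke c j
  have hfk0' : ∀ c (i : Fin (m + 2 + 1)), i ≠ c → fk c (X i) = 0 := fun c i hi => hfk0 c i (fun ⟨_, hj⟩ => hi hj.symm)
  -- the splitting `F(x_c := 1) = Φ + Ψ` at every marked vertex
  have hsplit : ∀ c, c ∈ S₁ ∨ c ∈ S₂ → ∃ (μ : ℕ) (Φ Ψ : MvPolynomial (Fin (m + 2)) K), 1 ≤ μ ∧ Φ.IsHomogeneous μ ∧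
      Ψ ∈ Ideal.span (Set.range (X : Fin (m + 2) → MvPolynomial (Fin (m + 2)) K)) ^ (μ + 1) ∧ ProjectiveSpace.dehomogenize K c F = Φ + Ψ := by
    rintro c (hc | hc)
    · obtain ⟨μ, Φ, Ψ, hμ, hΦ, -, hΨ, hdeh, -⟩ := hone c hc
      exact ⟨μ, Φ, Ψ, hμ, hΦ, hΨ, hdeh⟩
    · obtain ⟨μ, Φ, Ψ, -, hμ, hΦ, -, hΨ, hdeh, -⟩ := htwo c hc
      exact ⟨μ, Φ, Ψ, hμ, hΦ, hΨ, hdeh⟩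
  -- the chart equation of a marked vertex is radical
  have hrad : ∀ c, c ∈ S₁ ∨ c ∈ S₂ →
      (Ideal.span {ProjectiveSpace.dehomogenize K c F}).radical = Ideal.span {ProjectiveSpace.dehomogenize K c F} := by
    intro c hc
    obtain ⟨μ, Φ, Ψ, hμ, hΦ, hΨ, hdeh⟩ := hsplit c hc
    rw [hdeh]
    exact OrdPointAt.radical_span_dehomogenize_eq K F c hF hFp Φ Ψ hΦ hμ hΨ hdeh
  -- the vertex points of `V₊(F)`, `c ∈ S₁ ∪ S₂`
  have hvert : ∀ c, c ∈ S₁ ∨ c ∈ S₂ → ∃ (x₀ : ↥(hypersurface F).left)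
      (hx₀cl : IsClosed ({(hypersurfaceι F).left x₀} : Set (Proj (homogeneousSubmodule (Fin (m + 2 + 1)) K))))
      (hx₀cl' : IsClosed ({x₀} : Set ↥(hypersurface F).left)),
      ((Proj.map (fk c) (hfk' c)).ker.support : Set (Proj (homogeneousSubmodule (Fin (m + 2 + 1)) K))) = {(hypersurfaceι F).left x₀} ∧
      (∀ a : Fin (m + 2 + 1), a ≠ c → (X a : MvPolynomial (Fin (m + 2 + 1)) K) ∈ ((hypersurfaceι F).left x₀).asHomogeneousIdeal) ∧
      vanishingIdeal ⟨{(hypersurfaceι F).left x₀}, hx₀cl⟩ = (Proj.map (fk c) (hfk' c)).ker ∧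
      ((Proj.map (fk c) (hfk' c)).ker).comap (hypersurfaceι F).left = vanishingIdeal ⟨{x₀}, hx₀cl'⟩ := fun c hc =>
    exists_vertexPoint K F hF c (hsplit c hc) (fk c) (hfk' c) (hfkC c) (hfke' c) (hfk0' c)
  choose xpt hxcl hxcl' hxsupp hxX hxΛ hxcomap using hvert
  -- any point of `V₊(F)` at which all `x_a`, `a ≠ c`, vanish IS the vertex point
  have huniq : ∀ (c : Fin (m + 2 + 1)) (hc : c ∈ S₁ ∨ c ∈ S₂) (x : ↥(hypersurface F).left),
      (∀ a : Fin (m + 2 + 1), a ≠ c → (X a : MvPolynomial (Fin (m + 2 + 1)) K) ∈ ((hypersurfaceι F).left x).asHomogeneousIdeal) →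
      x = xpt c hc := by
    intro c hc x hxXa
    have hxmem : (hypersurfaceι F).left x ∈ ((Proj.map (fk c) (hfk' c)).ker.support : Set (Proj (homogeneousSubmodule (Fin (m + 2 + 1)) K))) := by
      by_contra h
      obtain ⟨a, ha, hXa⟩ := LinearCentre.exists_X_not_mem_of_not_mem_support (fun _ : Fin 1 => c) (he c) (fk c) (hfk' c) (hfkC c) (hfke c)
        (hfk0 c) h
      exact hXa (hxXa a ((OrdPointAt.not_mem_range_iff c (hec c) a).mp ha))
    rw [hxsupp c hc] at hxmem
    exact hιinj (Set.mem_singleton_iff.mp hxmem)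
  -- the finite sets of one-step / two-step singular points
  let SH₁ : Finset ↥(hypersurface F).left := S₁.toFinset.attach.image (fun c => xpt c.1 (Or.inl (List.mem_toFinset.mp c.2)))
  let SH₂ : Finset ↥(hypersurface F).left := S₂.toFinset.attach.image (fun c => xpt c.1 (Or.inr (List.mem_toFinset.mp c.2)))
  have hmemSH₁ : ∀ x, x ∈ SH₁ → ∃ (c : Fin (m + 2 + 1)) (hc : c ∈ S₁), xpt c (Or.inl hc) = x := fun x hx => by
    obtain ⟨c, -, h⟩ := Finset.mem_image.mp hx
    exact ⟨c.1, List.mem_toFinset.mp c.2, h⟩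
  have hmemSH₂ : ∀ x, x ∈ SH₂ → ∃ (c : Fin (m + 2 + 1)) (hc : c ∈ S₂), xpt c (Or.inr hc) = x := fun x hx => by
    obtain ⟨c, -, h⟩ := Finset.mem_image.mp hx
    exact ⟨c.1, List.mem_toFinset.mp c.2, h⟩
  have hmemSH : ∀ x, x ∈ SH₁ ∨ x ∈ SH₂ → ∃ (c : Fin (m + 2 + 1)) (hc : c ∈ S₁ ∨ c ∈ S₂), xpt c hc = x := by
    rintro x (hx | hx)
    · obtain ⟨c, hc, h⟩ := hmemSH₁ x hx; exact ⟨c, Or.inl hc, h⟩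
    · obtain ⟨c, hc, h⟩ := hmemSH₂ x hx; exact ⟨c, Or.inr hc, h⟩
  have hmemSH₁' : ∀ (c : Fin (m + 2 + 1)) (hc : c ∈ S₁), xpt c (Or.inl hc) ∈ SH₁ := fun c hc =>
    Finset.mem_image.mpr ⟨⟨c, List.mem_toFinset.mpr hc⟩, Finset.mem_attach _ _, rfl⟩
  have hmemSH₂' : ∀ (c : Fin (m + 2 + 1)) (hc : c ∈ S₂), xpt c (Or.inr hc) ∈ SH₂ := fun c hc =>
    Finset.mem_image.mpr ⟨⟨c, List.mem_toFinset.mpr hc⟩, Finset.mem_attach _ _, rfl⟩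
  have hmemSH' : ∀ (c : Fin (m + 2 + 1)) (hc : c ∈ S₁ ∨ c ∈ S₂), xpt c hc ∈ SH₁ ∨ xpt c hc ∈ SH₂ := by
    intro c hc
    rcases hc with hc | hc
    · exact Or.inl (hmemSH₁' c hc)
    · exact Or.inr (hmemSH₂' c hc)
  -- the generic point
  obtain ⟨ξ, hξ⟩ : ∃ ξ : ↥(hypersurface F).left, (hypersurfaceι F).left ξ = pointOfPrime F hF hFp := by
    have h : (pointOfPrime F hF hFp : Proj (homogeneousSubmodule (Fin (m + 2 + 1)) K)) ∈ Set.range (hypersurfaceι F).left := by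
      refine (Set.ext_iff.mp (range_hypersurfaceι F) _).mpr ((ProjectiveSpectrum.mem_zeroLocus _ _ _).mpr (Set.singleton_subset_iff.mpr ?_))
      exact Ideal.subset_span rfl
    exact h
  refine isoHypPoint_of_twoStepPoints K (m + 2) (hypersurface F).left (hypersurfaceι F).left SH₁ SH₂ ?_ ?_ ?_ ?_ ?_ ξ ?_
  · -- closed images
    intro x hx
    obtain ⟨c, hc, rfl⟩ := hmemSH x hx
    exact hxcl c hc
  · -- non-regular
    intro x hx
    obtain ⟨c, hc, rfl⟩ := hmemSH x hx
    exact hsingpt c hc _ (hxX c hc)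
  · -- regular off the vertices
    intro x hx₁ hx₂
    refine MultiOrd.isRegularLocalRing_stalk_of_forall_exists K F hF hd (S₁ ++ S₂)
      (fun c hc => ⟨hrad c (List.mem_append.mp hc), hsing c (List.mem_append.mp hc)⟩)
      (fun c hc => hoff c (fun h => hc (List.mem_append.mpr (Or.inl h))) (fun h => hc (List.mem_append.mpr (Or.inr h)))) x (fun c hc => ?_)
    have hc' : c ∈ S₁ ∨ c ∈ S₂ := List.mem_append.mp hc
    have hxc : (hypersurfaceι F).left x ∉ ((Proj.map (fk c) (hfk' c)).ker.support : Set (Proj (homogeneousSubmodule (Fin (m + 2 + 1)) K))) := by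
      rw [hxsupp c hc']
      intro h
      have hxe : x = xpt c hc' := hιinj (Set.mem_singleton_iff.mp h)
      rcases hmemSH' c hc' with h₁ | h₂
      · exact hx₁ (hxe ▸ h₁)
      · exact hx₂ (hxe ▸ h₂)
    obtain ⟨a, ha, hXa⟩ := LinearCentre.exists_X_not_mem_of_not_mem_support (fun _ : Fin 1 => c) (he c) (fk c) (hfk' c) (hfkC c) (hfke c)
      (hfk0 c) hxc
    exact ⟨a, (OrdPointAt.not_mem_range_iff c (hec c) a).mp ha, (Proj.mem_basicOpen _ _ _).mpr hXa⟩
  · -- one-step, pointwise over each vertex of `S₁`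
    intro x hx hxcl₀ Z τ hτ z hz
    obtain ⟨c, hc, rfl⟩ := hmemSH₁ x hx
    obtain ⟨μ, Φ, Ψ, hμ, hΦ, hΦ0, hΨ, hdeh, hG⟩ := hone c hc
    have hτ' : IsBlowup τ (((Proj.map (fk c) (hfk' c)).ker).comap (hypersurfaceι F).left) := by rw [hxcomap c (Or.inl hc)]; exact hτ
    refine OneStep.isRegularLocalRing_stalk_of_isBlowup_comap K F c hF hFp (hec c) (fk c) (hfk' c) (hfkC c) (hfke c) (hfk0 c)
      Φ Ψ hΦ hμ hΦ0 hΨ hdeh hG hτ' z ?_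
    have hgoal : (hypersurfaceι F).left (τ z) ∈ ((Proj.map (fk c) (hfk' c)).ker.support : Set (Proj (homogeneousSubmodule (Fin (m + 2 + 1)) K))) := by
      rw [hz, hxsupp c (Or.inl hc)]; rfl
    rw [Scheme.IdealSheafData.support_comap]
    exact hgoal
  · -- two-step, over each vertex of `S₂`
    intro x hx hxcl₀ Z τ hτ
    obtain ⟨c, hc, rfl⟩ := hmemSH₂ x hx
    obtain ⟨μ, Φ, Ψ, G, hμ, hΦ, hΦ0, hΨ, hdeh, hG, hjac, hsec⟩ := htwo c hc
    have hradΦ : (Ideal.span {Φ + Ψ}).radical = Ideal.span {Φ + Ψ} := by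
      have h := hrad c (Or.inr hc)
      rwa [hdeh] at h
    obtain ⟨x₀, hx₀cl', hx₀X, htwo₀⟩ := twoStepAt_vertex K F hF hd c Φ Ψ hμ hΦ hΦ0 hΨ hdeh hradΦ G hG hjac hsec
    have hx₀ : x₀ = xpt c (Or.inr hc) := huniq c (Or.inr hc) x₀ hx₀X
    subst hx₀
    exact htwo₀ Z τ hτ
  · -- the generic point is no vertex
    intro x hx h
    obtain ⟨c, hc, rfl⟩ := hmemSH x hx
    obtain ⟨a, hac, ha⟩ := MultiOrd.exists_X_ne_not_mem_span K F hFp c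
    have hmem : (hypersurfaceι F).left ξ ∈ ((Proj.map (fk c) (hfk' c)).ker.support : Set (Proj (homogeneousSubmodule (Fin (m + 2 + 1)) K))) := by
      rw [hxsupp c hc, ← h]; rfl
    rw [hξ] at hmem
    exact ha (LinearCentre.X_mem_asHomogeneousIdeal_of_mem_support (fun _ : Fin 1 => c) (fk c) (hfk' c) (hfkC c) (hfke c) (hfk0 c) hmem
      (fun ⟨_, hj⟩ => hac hj.symm))


/-- ★★ **SEVERAL ONE-STEP AND `A₃` VERTICES OF A PRIME SURFACE ⟹ `IsoHypPoint`**: `F ∈ K[x₀,…,x₃]` a prime form, `S₁` one-step vertices (datum of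
✓ `isoHypPoint_of_oneStepVertices`), `S₂` vertices with an `A₃` chart `F(x_c := 1) = y₀y₁ + ((y₂²(αy₀ + βy₁) + Ψ₁⁰) + (γy₂⁴ + Ψ₂⁰ + Ψ₅))` (`γ ≠ αβ`,
`Ψ₁⁰ ∈ (y₀,y₁)²` cubic form, `Ψ₂⁰ ∈ (y₀,y₁)` quartic form, `Ψ₅ ∈ (y)⁵`); marked charts singular at most at the origin and non-regular there, unmarked charts
regular.  Then `IsoHypPoint K (1+2) V₊(F) ι` — by ✓ `isoHypPoint_of_twoStepVertices` with the two-step datum ✓ `SecondOrderPoint.twoStepData_A₃`.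
[OURS] [cite: Hartshorne1977, I Thm. 5.1, I Ex. 5.6] [cite: StacksProject, Tag 080E] -/
theorem isoHypPoint_of_A₃Vertices (K : Type) [Field K] [IsAlgClosed K]
    (F : MvPolynomial (Fin (1 + 2 + 1)) K) {d : ℕ} (hF : F.IsHomogeneous d) (hFp : Prime F)
    (S₁ S₂ : List (Fin (1 + 2 + 1)))
    (hone : ∀ c ∈ S₁, ∃ (μ : ℕ) (Φ Ψ : MvPolynomial (Fin (1 + 2)) K), 1 ≤ μ ∧ Φ.IsHomogeneous μ ∧ Φ ≠ 0 ∧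
      Ψ ∈ Ideal.span (Set.range (X : Fin (1 + 2) → MvPolynomial (Fin (1 + 2)) K)) ^ (μ + 1) ∧ ProjectiveSpace.dehomogenize K c F = Φ + Ψ ∧
      ∀ l : Fin (1 + 2), ∃ G : MvPolynomial (Fin (1 + 2)) K,
        aeval (fun j => X l * Function.update (X : Fin (1 + 2) → MvPolynomial (Fin (1 + 2)) K) l 1 j) (Φ + Ψ) = X l ^ μ * G ∧
        ∀ P : Ideal (MvPolynomial (Fin (1 + 2)) K), P.IsPrime → (X l : MvPolynomial (Fin (1 + 2)) K) ∈ P → G ∈ P → ∃ j, pderiv j G ∉ P)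
    (hA₃ : ∀ c ∈ S₂, ∃ (α β γ : K) (Ψ₁₀ Ψ₂₀ Ψ₅ : MvPolynomial (Fin 3) K), γ ≠ α * β ∧
      Ψ₁₀.IsHomogeneous 3 ∧ Ψ₁₀ ∈ Ideal.span {(X 0 : MvPolynomial (Fin 3) K), X 1} ^ 2 ∧
      Ψ₂₀.IsHomogeneous 4 ∧ Ψ₂₀ ∈ Ideal.span {(X 0 : MvPolynomial (Fin 3) K), X 1} ∧
      Ψ₅ ∈ Ideal.span (Set.range (X : Fin 3 → MvPolynomial (Fin 3) K)) ^ 5 ∧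
      ProjectiveSpace.dehomogenize K c F = X 0 * X 1 + ((X 2 ^ 2 * (C α * X 0 + C β * X 1) + Ψ₁₀) + (C γ * X 2 ^ 4 + Ψ₂₀ + Ψ₅)))
    (hsing : ∀ c, c ∈ S₁ ∨ c ∈ S₂ → ∀ P : Ideal (MvPolynomial (Fin (1 + 2)) K), P.IsPrime → ProjectiveSpace.dehomogenize K c F ∈ P →
      (∀ j, pderiv j (ProjectiveSpace.dehomogenize K c F) ∈ P) → ∀ j, (X j : MvPolynomial (Fin (1 + 2)) K) ∈ P)
    (hsingpt : letI := MvPolynomial.gradedAlgebra (σ := Fin (1 + 2 + 1)) (R := K)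
      ∀ c, c ∈ S₁ ∨ c ∈ S₂ → ∀ x : ↥(hypersurface F).left, (∀ a : Fin (1 + 2 + 1), a ≠ c →
        (X a : MvPolynomial (Fin (1 + 2 + 1)) K) ∈ ((hypersurfaceι F).left x).asHomogeneousIdeal) →
        ¬ IsRegularLocalRing ((hypersurface F).left.presheaf.stalk x))
    (hoff : letI := MvPolynomial.gradedAlgebra (σ := Fin (1 + 2 + 1)) (R := K)
      ∀ c, c ∉ S₁ → c ∉ S₂ → IsRegularRing (ChartRing F c hF)) :
    letI := MvPolynomial.gradedAlgebra (σ := Fin (1 + 2 + 1)) (R := K)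
    IsoHypPoint K (1 + 2) (hypersurface F).left (hypersurfaceι F).left := by
  refine isoHypPoint_of_twoStepVertices K F hF hFp S₁ S₂ hone (fun c hc => ?_) hsing hsingpt hoff
  obtain ⟨α, β, γ, Ψ₁₀, Ψ₂₀, Ψ₅, hdisc, hΨ₁₀h, hΨ₁₀, hΨ₂₀h, hΨ₂₀, hΨ₅, hdeh⟩ := hA₃ c hc
  obtain ⟨hΨ, G, hG, hjac, hsec⟩ := SecondOrderPoint.twoStepData_A₃ K α β γ hdisc hΨ₁₀h hΨ₁₀ hΨ₂₀h hΨ₂₀ hΨ₅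
  have hΦ : (X 0 * X 1 : MvPolynomial (Fin 3) K).IsHomogeneous 2 := by
    simpa using (isHomogeneous_X K (0 : Fin 3)).mul (isHomogeneous_X K (1 : Fin 3))
  have hΦ0 : (X 0 * X 1 : MvPolynomial (Fin 3) K) ≠ 0 := mul_ne_zero (X_ne_zero 0) (X_ne_zero 1)
  exact ⟨2, X 0 * X 1, _, G, by norm_num, hΦ, hΦ0, hΨ, hdeh, hG, hjac, hsec⟩

end Summit.ResolutionOfSingularities.ResolutionOfSingularities.Cruxes.EquisingularLiftNat.Sections

end
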